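import Mathlib

/-!
# NoGo/EPhiTLD (nogo g12; filed p232556) — kernel shadow of THEOREM N21

search for candidate a priori estimates; no regularity claim.

THEOREM N21 (paper: `pub-nsfunc-nogo/ephi/N21-TLD.md`, SIEVELD v1.6 §5.4): the dictionary row
`EPhi.q=2.RQ.j=1 | T_LD | G1` HOLDS for some finite κ, i.e. for
`F = ∫|ω|² log(e + |ω|K/(νZ))` one has `dF/dt ≤ κ ν⁻³ Z F²` along smooth zero-mean solutions on 𝕋³.

This file checks ONLY the real-arithmetic / one-variable-calculus steps of the proof:
* `L_ge_rho`      : log(1 + r/e) ≥ r/(e + r)                       (N21 §1 (2))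
* `weight_cmp`    : 0 < w = 2ℓ + ρ − 2ρ̄ ≤ 3(ℓ − ρ̄)                 (N21 §1 (3))
* `hess_floor`, `matched_weight` : Hessian coefficients ≥ 2ℓ, resp. ≥ 2ℓ + ρ (dict T1)
* `grad_coeff`    : L + ρ + ρ²/(4L) ≤ (9/4)L for 0 ≤ ρ ≤ L          (N21 §3 (4))
* `lemmaR_hi`, `lemmaR_lo`, `lemmaR_small_pt`, `C_R_bound` : the pointwise inequalities behind
  LEMMA R and the numerical constant C_R = (1 + 1/e)/√(log 2) ≤ 1.65   (N21 §3 (5))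
* `bookkeeping`   : the exponent algebra of N21 §2–§4 in fourth-root variables.

NOT checked here (hypotheses of the paper proof, cited): the evolution identity N20.1, the
3-D Ladyzhenskaya / Gagliardo–Nirenberg and Poincaré inequalities on 𝕋³, ‖S‖₂ ≤ ‖∇u‖₂, and the
measure-theoretic assembly of Lemma R from its pointwise cases. Nothing about Navier–Stokes
regularity is stated or implied.
-/

namespace Summit.NavierStokesRegularity.FunctionalMining.NoGo.EPhiTLD

open Real

/-- N21 (2): `L ≥ ρ`, i.e. `log(1 + r/e) ≥ r/(e + r)` for `r ≥ 0`. -/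
theorem L_ge_rho (r : ℝ) (hr : 0 ≤ r) :
    r / (Real.exp 1 + r) ≤ Real.log (1 + r / Real.exp 1) := by
  have he : 0 < Real.exp 1 := Real.exp_pos 1
  have hx : 0 < 1 + r / Real.exp 1 := by positivity
  have h1 := Real.one_sub_inv_le_log_of_pos hx
  have hne1 : Real.exp 1 + r ≠ 0 := by positivity
  have hne2 : 1 + r / Real.exp 1 ≠ 0 := by positivity
  have hrew : r / (Real.exp 1 + r) = 1 - (1 + r / Real.exp 1)⁻¹ := by
    field_simp
    ring
  rw [hrew]
  exact h1

/-- N21 (3): the WEIGHT COMPARISON. With `ℓ = 1 + L`, `0 ≤ ρ ≤ L`, `ρ̄ < 1` (the paper has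
`0 ≤ ρ̄ < 1`; nonnegativity of `ρ̄` is not needed): `0 < w := 2ℓ + ρ − 2ρ̄ ≤ 3 (ℓ − ρ̄)`. -/
theorem weight_cmp (L ρ ρb : ℝ) (hρ : 0 ≤ ρ) (hL : ρ ≤ L) (hb1 : ρb < 1) :
    0 < 2 * (1 + L) + ρ - 2 * ρb ∧ 2 * (1 + L) + ρ - 2 * ρb ≤ 3 * ((1 + L) - ρb) := by
  constructor <;> nlinarith

/-- Hessian coefficients of `Ψ = |ω|² ℓ`: `2ℓ + 4ρ − ρ² ≥ 2ℓ` and `2ℓ + ρ ≥ 2ℓ` for `ρ ∈ [0,1]`. -/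
theorem hess_floor (l ρ : ℝ) (h0 : 0 ≤ ρ) (h1 : ρ ≤ 1) :
    2 * l ≤ 2 * l + 4 * ρ - ρ ^ 2 ∧ 2 * l ≤ 2 * l + ρ := by
  constructor <;> nlinarith

/-- dict T1 (matched weights): `2ℓ + 4ρ − ρ² ≥ 2ℓ + ρ` for `ρ ∈ [0,1]`. -/
theorem matched_weight (l ρ : ℝ) (h0 : 0 ≤ ρ) (h1 : ρ ≤ 1) :
    2 * l + ρ ≤ 2 * l + 4 * ρ - ρ ^ 2 := by
  nlinarith

/-- N21 (4): the gradient coefficient of `ṽ = L^{1/2} ω`: `L + ρ + ρ²/(4L) ≤ (9/4) L`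
whenever `0 ≤ ρ ≤ L` and `0 < L`. -/
theorem grad_coeff (L ρ : ℝ) (hL : 0 < L) (h0 : 0 ≤ ρ) (h1 : ρ ≤ L) :
    L + ρ + ρ ^ 2 / (4 * L) ≤ (9 / 4) * L := by
  have h4 : 0 < 4 * L := by linarith
  have hsq : ρ ^ 2 / (4 * L) ≤ ρ / 4 := by
    rw [div_le_iff₀ h4]
    nlinarith
  linarith

/-- LEMMA R, upper case: for `0 < y₀ ≤ y`, `y · log((1+y)/(1+y₀)) ≤ y²/y₀`. -/
theorem lemmaR_hi (y y0 : ℝ) (hy0 : 0 < y0) (hy : y0 ≤ y) :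
    y * Real.log ((1 + y) / (1 + y0)) ≤ y ^ 2 / y0 := by
  have hypos : 0 < y := lt_of_lt_of_le hy0 hy
  have hq : 0 < (1 + y) / (1 + y0) := by positivity
  have hlog : Real.log ((1 + y) / (1 + y0)) ≤ (1 + y) / (1 + y0) - 1 :=
    Real.log_le_sub_one_of_pos hq
  have hfrac : (1 + y) / (1 + y0) - 1 ≤ y / y0 := by
    rw [div_sub_one (by positivity : (1 + y0) ≠ 0)]
    rw [div_le_div_iff₀ (by positivity) hy0]
    nlinarith
  calc y * Real.log ((1 + y) / (1 + y0)) ≤ y * (y / y0) := by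
        exact mul_le_mul_of_nonneg_left (le_trans hlog hfrac) hypos.le
    _ = y ^ 2 / y0 := by ring

/-- `log u ≤ u / e` for `u > 0`. -/
theorem log_le_div_exp_one (u : ℝ) (hu : 0 < u) : Real.log u ≤ u / Real.exp 1 := by
  have he : 0 < Real.exp 1 := Real.exp_pos 1
  have hue : 0 < u / Real.exp 1 := by positivity
  have h := Real.log_le_sub_one_of_pos hue
  rw [Real.log_div hu.ne' he.ne', Real.log_exp] at h
  linarith

/-- LEMMA R, lower case: for `0 ≤ y ≤ y₀`, `0 < y₀`: `y · log((1+y₀)/(1+y)) ≤ y₀/e`. -/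
theorem lemmaR_lo (y y0 : ℝ) (hy0 : 0 < y0) (h0 : 0 ≤ y) (hy : y ≤ y0) :
    y * Real.log ((1 + y0) / (1 + y)) ≤ y0 / Real.exp 1 := by
  have he : 0 < Real.exp 1 := Real.exp_pos 1
  rcases eq_or_lt_of_le h0 with h | h
  · rw [← h]; simp; positivity
  · -- y > 0: (1+y0)/(1+y) ≤ y0/y and y log(y0/y) = y0 (log t)/t ≤ y0/e
    have hq : 0 < (1 + y0) / (1 + y) := by positivity
    have hmono : Real.log ((1 + y0) / (1 + y)) ≤ Real.log (y0 / y) := by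
      apply Real.log_le_log hq
      rw [div_le_div_iff₀ (by positivity) h]
      nlinarith
    have ht : 0 < y0 / y := by positivity
    have hlt : Real.log (y0 / y) ≤ (y0 / y) / Real.exp 1 := log_le_div_exp_one _ ht
    calc y * Real.log ((1 + y0) / (1 + y)) ≤ y * Real.log (y0 / y) :=
          mul_le_mul_of_nonneg_left hmono h.le
      _ ≤ y * ((y0 / y) / Real.exp 1) := mul_le_mul_of_nonneg_left hlt h.le
      _ = y0 / Real.exp 1 := by field_simp

/-- LEMMA R, small case pointwise: `log(1 + y) ≤ y` for `y ≥ 0` (so `q(y) = √log(1+y) ≤ √y`). -/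
theorem lemmaR_small_pt (y : ℝ) (hy : 0 ≤ y) :
    Real.log (1 + y) ≤ y ∧ Real.sqrt (Real.log (1 + y)) ≤ Real.sqrt y := by
  have h : Real.log (1 + y) ≤ y := by
    have := Real.log_le_sub_one_of_pos (by linarith : (0:ℝ) < 1 + y)
    linarith
  exact ⟨h, Real.sqrt_le_sqrt h⟩

/-- LEMMA R, small case moments: for `0 < m ≤ 1`, `m^{3/4} ≤ m^{1/2}`. -/
theorem lemmaR_small_moment (m : ℝ) (hm0 : 0 < m) (hm1 : m ≤ 1) :
    m ^ ((3:ℝ)/4) ≤ m ^ ((1:ℝ)/2) := by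
  apply Real.rpow_le_rpow_of_exponent_ge hm0 hm1
  norm_num

/-- The constant of LEMMA R: `C_R = (1 + 1/e)/√(log 2) ≤ 1.65`, in the square-root-free form
`(1 + 1/e) ≤ 1.65 · √(log 2)`. -/
theorem C_R_bound : 1 + (Real.exp 1)⁻¹ ≤ 1.65 * Real.sqrt (Real.log 2) := by
  have he : Real.exp 1 > 2.7182818283 := Real.exp_one_gt_d9
  have hl : Real.log 2 > 0.6931471803 := Real.log_two_gt_d9
  have hepos : 0 < Real.exp 1 := Real.exp_pos 1
  have hinv : (Real.exp 1)⁻¹ < 1 / 2.7182818283 := by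
    rw [inv_eq_one_div]
    exact one_div_lt_one_div_of_lt (by norm_num) he
  have hs : Real.sqrt 0.6931471803 ≤ Real.sqrt (Real.log 2) := Real.sqrt_le_sqrt hl.le
  have hs2 : (0.8325 : ℝ) ≤ Real.sqrt 0.6931471803 := by
    rw [show (0.8325:ℝ) = Real.sqrt (0.8325 ^ 2) by rw [Real.sqrt_sq (by norm_num)]]
    exact Real.sqrt_le_sqrt (by norm_num)
  nlinarith

/-- The case-2 assembly of LEMMA R as pure arithmetic: if the two partial expectations satisfy
`A ≤ m₂ / y₀` (upper levels) and `B ≤ y₀ / e` (lower levels) with `y₀ = √m₂`, `m₂ ≥ 1`, and the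
common denominator is `q(y₀) = √(log(1 + y₀)) ≥ √(log 2)`, then `(A + B)/q(y₀) ≤ 1.65 √m₂`. -/
theorem lemmaR_case2 (m2 A B q0 : ℝ) (hm : 1 ≤ m2)
    (hA : A ≤ m2 / Real.sqrt m2) (hB : B ≤ Real.sqrt m2 / Real.exp 1)
    (hq : Real.sqrt (Real.log 2) ≤ q0) :
    (A + B) / q0 ≤ 1.65 * Real.sqrt m2 := by
  have hl : Real.log 2 > 0.6931471803 := Real.log_two_gt_d9
  have hsl : 0 < Real.sqrt (Real.log 2) := Real.sqrt_pos.mpr (by linarith)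
  have hq0 : 0 < q0 := lt_of_lt_of_le hsl hq
  have hm0 : 0 < m2 := by linarith
  have hsm : 0 < Real.sqrt m2 := Real.sqrt_pos.mpr hm0
  have hmsq : m2 / Real.sqrt m2 = Real.sqrt m2 := by
    rw [div_eq_iff hsm.ne']
    exact (Real.mul_self_sqrt hm0.le).symm
  have hAB : A + B ≤ Real.sqrt m2 * (1 + (Real.exp 1)⁻¹) := by
    rw [hmsq] at hA
    have : Real.sqrt m2 / Real.exp 1 = Real.sqrt m2 * (Real.exp 1)⁻¹ := by
      rw [div_eq_mul_inv]
    rw [this] at hB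
    have e1 : Real.sqrt m2 * (1 + (Real.exp 1)⁻¹) = Real.sqrt m2 + Real.sqrt m2 * (Real.exp 1)⁻¹ := by ring
    rw [e1]
    linarith
  have hC := C_R_bound
  rw [div_le_iff₀ hq0]
  calc A + B ≤ Real.sqrt m2 * (1 + (Real.exp 1)⁻¹) := hAB
    _ ≤ Real.sqrt m2 * (1.65 * Real.sqrt (Real.log 2)) :=
        mul_le_mul_of_nonneg_left hC hsm.le
    _ ≤ Real.sqrt m2 * (1.65 * q0) := by
        apply mul_le_mul_of_nonneg_left _ hsm.le
        nlinarith
    _ = 1.65 * Real.sqrt m2 * q0 := by ring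

/-- EXPONENT BOOKKEEPING of N21 §2–§4 in fourth-root variables: write `Z = a⁴`, `F = f⁴`,
`D₀ = d⁴` with `0 < a ≤ f` (i.e. `0 < Z ≤ F`), `0 < d` and `2a⁴ ≤ d⁴` (i.e. `2Z ≤ D₀`). If the two
production pieces obey `N₁ ≤ c₁ · d³ · a³` (term (I): `D₀^{3/4} Z^{3/4}`) and
`N₂ ≤ c₂ · a² · f · d³ + c₃ · a⁶` (term (II): `Z^{1/2} F^{1/4} D₀^{3/4}` and `Z^{3/2}`), and `s` is
any constant with `a³ ≤ s · d³` guaranteed by `8 a¹² ≤ d¹²` (so `s = 2^{-3/4}` works), then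
`N₁ + N₂ ≤ (c₁ + c₂ + c₃ s) · d³ · a · f²`, i.e. `N_F ≤ C_N D₀^{3/4} Z^{1/4} F^{1/2}`. -/
theorem bookkeeping (a f d s c1 c2 c3 N1 N2 : ℝ) (ha : 0 < a) (haf : a ≤ f) (hd : 0 < d)
    (h2 : 2 * a ^ 4 ≤ d ^ 4) (hc1 : 0 ≤ c1) (hc2 : 0 ≤ c2) (hc3 : 0 ≤ c3) (hs : 0 ≤ s)
    (hsd : ∀ x : ℝ, 0 < x → 8 * x ^ 12 ≤ d ^ 12 → x ^ 3 ≤ s * d ^ 3)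
    (hN1 : N1 ≤ c1 * d ^ 3 * a ^ 3) (hN2 : N2 ≤ c2 * a ^ 2 * f * d ^ 3 + c3 * a ^ 6) :
    N1 + N2 ≤ (c1 + c2 + c3 * s) * d ^ 3 * a * f ^ 2 := by
  have hf : 0 < f := lt_of_lt_of_le ha haf
  have hd3 : 0 < d ^ 3 := by positivity
  -- a³ ≤ a f², a² f ≤ a f²
  have h13 : a ^ 3 ≤ a * f ^ 2 := by nlinarith [mul_le_mul haf haf ha.le hf.le]
  have h23 : a ^ 2 * f ≤ a * f ^ 2 := by nlinarith
  -- 8 a¹² ≤ d¹² from 2a⁴ ≤ d⁴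
  have h12 : 8 * a ^ 12 ≤ d ^ 12 := by
    have h4 : 0 ≤ 2 * a ^ 4 := by positivity
    have := pow_le_pow_left₀ h4 h2 3
    nlinarith [this]
  have ha3 : a ^ 3 ≤ s * d ^ 3 := hsd a ha h12
  have h63 : a ^ 6 ≤ s * d ^ 3 * a ^ 3 := by nlinarith [pow_pos ha 3]
  have h6 : a ^ 6 ≤ s * d ^ 3 * (a * f ^ 2) := by
    calc a ^ 6 ≤ s * d ^ 3 * a ^ 3 := h63
      _ ≤ s * d ^ 3 * (a * f ^ 2) := by
          apply mul_le_mul_of_nonneg_left h13; positivity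
  have t1 : c1 * d ^ 3 * a ^ 3 ≤ c1 * d ^ 3 * (a * f ^ 2) := by
    apply mul_le_mul_of_nonneg_left h13; positivity
  have t2 : c2 * a ^ 2 * f * d ^ 3 ≤ c2 * d ^ 3 * (a * f ^ 2) := by
    have := mul_le_mul_of_nonneg_left h23 (by positivity : 0 ≤ c2 * d ^ 3)
    nlinarith [this]
  have t3 : c3 * a ^ 6 ≤ c3 * (s * d ^ 3 * (a * f ^ 2)) := mul_le_mul_of_nonneg_left h6 hc3
  nlinarith [t1, t2, t3]

/-- The constant `s = 2^{-3/4}` qualifies for `bookkeeping`: if `8 x¹² ≤ d¹²` with `x, d > 0` then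
`x³ ≤ 2^{-3/4} d³`; we state it with `s⁴ = 1/8`, `s > 0` abstractly. -/
theorem s_qualifies (s d : ℝ) (hs : 0 < s) (hs4 : s ^ 4 = 1 / 8) (hd : 0 < d) :
    ∀ x : ℝ, 0 < x → 8 * x ^ 12 ≤ d ^ 12 → x ^ 3 ≤ s * d ^ 3 := by
  intro x hx h
  have hsd : 0 < s * d ^ 3 := by positivity
  -- compare fourth powers
  have h4 : (x ^ 3) ^ 4 ≤ (s * d ^ 3) ^ 4 := by
    have : (s * d ^ 3) ^ 4 = s ^ 4 * d ^ 12 := by ring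
    rw [this, hs4]
    have : (x ^ 3) ^ 4 = x ^ 12 := by ring
    rw [this]
    linarith
  exact (pow_le_pow_iff_left₀ (by positivity) hsd.le (by norm_num : (4:ℕ) ≠ 0)).1 h4

/-- SIEVELD Lemma 0, the optimisation step used to turn the static bound into κ: for
`N ≤ C · D^{3/4} · B^{1/4}` (here `B = Z F²`) one has `N ≤ ν D + κ ν⁻³ B` for every `ν > 0` as soon as
`κ ≥ C⁴ / c₃⁴`, `c₃ = 4 · 3^{-3/4}`; we check the underlying Young inequality in the form
`4 · p³ q ≤ 3 p⁴ + q⁴` for `p, q ≥ 0` (AM–GM with weights 3/4, 1/4). -/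
theorem young_34 (p q : ℝ) (hp : 0 ≤ p) (hq : 0 ≤ q) : 4 * (p ^ 3 * q) ≤ 3 * p ^ 4 + q ^ 4 := by
  have h3 : 0 ≤ 3 * p ^ 2 + 2 * p * q + q ^ 2 := by nlinarith [mul_nonneg hp hq, sq_nonneg p, sq_nonneg q]
  -- 3p⁴ + q⁴ − 4p³q = (p − q)² (3p² + 2pq + q²)
  nlinarith [mul_nonneg (sq_nonneg (p - q)) h3]

end Summit.NavierStokesRegularity.FunctionalMining.NoGo.EPhiTLD
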